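import Mathlib
import Literature.Analysis.FluidPDE.SelfSimilar
import Literature.Analysis.FluidPDE.TypeIAncientMild
import Literature.Analysis.FluidPDE.CurlFreeLiouville
import Summits.NavierStokesRegularity.NavierStokesRegularity.Theorems.SymmetryModuliCountStretchingCertificateComparison
import Summits.NavierStokesRegularity.NavierStokesRegularity.Theorems.DssFarFieldSlavingBlowupTypeIDssProfileSmoothRepresentativeAe
import HarnessLib

/-!
# The sub-critical CERTIFICATE-DEFECT slice is EMPTY (pub-ns-dss theory T35 / row E27)
  (route `DssFarFieldSlaving`, crux `BlowupTypeIDssProfile`, stmt-NavierStokesRegularity-0155 — SUPPORT;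
  cell pub-ns-dss, theory seat g5, 2026-08-22; statements for the typer seat to land; this file
  type-checks as written.)

HONEST FRAMING. Nothing here is new analysis and nothing here is a statement about Navier–Stokes
regularity or blow-up: the two theorems below are the constant-weight (`h ≡ 1`) instance of route
`SymmetryModuliCount`'s CLOSED item `StretchingCertificateComparison` (stmt-NavierStokesRegularity-14340,
tree theorem `stretchCert_curl_eq_zero`), read WITHOUT discarding the direction-coherence term. An
empty slice is a solver control / a ghost index for the census, never evidence about regularity.

* `typeI_ancient_subcriticalCertificate_eq_zero` (classical, Oseen gauge — theory T35): a Type-I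
  ancient mild field `V` (`IsTypeIAncientMild C V`, ANY constant `C`) such that at every point with
  `ω = curl V ≠ 0`, with `ξ = ω/|ω|`,
  `(−t) · (⟪∇V ξ, ξ⟫ − |∇ξ|²_F) ≤ Λ` for some `Λ < 1`
  (stretching rate ALONG the vorticity direction, net of the squared Frobenius norm of the gradient
  of the direction field — Constantin–Fefferman's term — is sub-critical with respect to the
  similarity damping rate `1` of `Ω = (−t)ω`) vanishes identically. In similarity variables the
  hypothesis reads `sup_{Ω ≠ 0} (ξ̃ᵀ S̃ ξ̃ − |∇_y ξ̃|²_F) < 1`.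
* `subcriticalStrain_subcriticalCertificate`: the strain hypothesis of T32
  (`⟪∇V ξ, ξ⟫ ≤ (Λ/(−t))‖ξ‖²` for all `ξ`) implies the certificate hypothesis with the same `Λ` —
  so T35 contains T32 (`SubcriticalStrain.typeI_ancient_subcriticalStrain_eq_zero`, typer file
  fed83df7f8cc2bde) and is silent on a strictly smaller set of fields.
* `rdssClass_subcriticalCertificate_empty` (CLASS level, row E27): for every Type-I bound `M` and
  every `Λ < 1`, no member of the hypothesis class of `Theses.FilamentSkeletonRss.RdssProfileTruncation`
  (H0 `1 < c`, H5 ancient mild, H4 measurable slices, H2 `(c, R)`-RDSS, H3 `HasTypeIDecay M u`,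
  H6 non-trivial) has all its smooth Type-I representatives `V` (`IsTypeIAncientMild M V`,
  `V t =ᵐ u t`; one exists by `typeI_ancient_smoothRepresentative_ae`) sub-critically certified.

WHY IT STOPS (honest): perturbative in the certificate defect `1 − Λ`; no registered cell parameter
(c, ord R, isotropy, α, final trace) forces the hypothesis, and the Type-I constant bounds the
certificate quantity only through the inexplicit KNSS gauge gradient bound `K₀(M)` (a collar of the
zero endpoint). Printed qualitative cousins (no threshold): Constantin–Fefferman 1993 (Lipschitz
coherence of `ξ`), Giga–Miura 2011 (Type I + uniformly continuous `ξ` ⇒ no blow-up; in the tree as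
`continuousAlignmentRegular`), Lei–Ren–Tian 2025 (double cone; tree fact
`LeiRenTian2025_doubleCone_regularity`). No printed quantitative form of T35 was located (theory g5
presearch 2026-08-22: corpus fts+vec «vorticity direction stretching Type I ancient Liouville»,
galaxy pdf «Giga-Miura|vorticity direction and type I»).
[cite: KochNadirashviliSereginSverak2009, Lemma 3.1 and Remark 6.1 (arXiv:0709.3599)]
[cite: ConstantinFefferman1993, §1]
-/

noncomputable section

set_option linter.dupNamespace false

namespace Summit.NavierStokesRegularity.NavierStokesRegularity.Theorems.CertificateThreshold

open Set Function Filter MeasureTheory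
open scoped RealInnerProductSpace Laplacian ContDiff Topology
open Literature.Analysis Literature.Analysis.FluidPDE
open Summit.NavierStokesRegularity.NavierStokesRegularity.Theorems

/-- **T35 (classical, Oseen gauge): a sub-critical certificate defect forces triviality.** A Type-I
ancient mild field `V` in the KNSS gauge (any constant `C`) with
`(−t)(⟪∇V(t,x) ξ, ξ⟫ − |∇ξ(t,x)|²_F) ≤ Λ` at every `t < 0`, `x` with `curl V(t) x ≠ 0`
(`ξ = vorticityDirection (curl (V t))`), for some `Λ < 1`, vanishes for all `t < 0`. Proof: `h ≡ 1`,
`δ = 1 − Λ`, `A = 0` is a stretching certificate, hence `curl V ≡ 0` (`stretchCert_curl_eq_zero`),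
the slices are constant (`eq_of_curl_eq_zero_of_isDivFree_of_bounded`) and the gauge kills them
(`IsTypeIAncientMild.eq_zero_of_slice_const`). [cite: KochNadirashviliSereginSverak2009, Lemma 3.1 and Remark 6.1 (arXiv:0709.3599)] -/
theorem typeI_ancient_subcriticalCertificate_eq_zero {C Λ : ℝ} (hΛ : Λ < 1)
    {V : ℝ → EuclideanSpace ℝ (Fin 3) → EuclideanSpace ℝ (Fin 3)} (hV : IsTypeIAncientMild C V)
    (hcert : ∀ t < 0, ∀ x : EuclideanSpace ℝ (Fin 3), curl (V t) x ≠ 0 →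
      (-t) * (⟪fderiv ℝ (V t) x (vorticityDirection (curl (V t)) x),
          vorticityDirection (curl (V t)) x⟫
        - frobeniusNormSq (fderiv ℝ (vorticityDirection (curl (V t))) x)) ≤ Λ) :
    ∀ t < 0, ∀ x, V t x = 0 := by
  intro t ht x
  -- the constant certificate `h ≡ 1`, `δ = 1 - Λ`, `A = 0`
  have hh : IsSmoothSpaceTimeOn (Iio 0) (fun (_ : ℝ) (_ : EuclideanSpace ℝ (Fin 3)) => (1 : ℝ)) :=
    contDiffOn_const
  have hh1 : ∀ s < (0 : ℝ), ∀ (y : EuclideanSpace ℝ (Fin 3)),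
      1 ≤ (fun (_ : ℝ) (_ : EuclideanSpace ℝ (Fin 3)) => (1 : ℝ)) s y := fun _ _ _ => le_rfl
  have hgrad1 : ∀ s < (0 : ℝ), ∀ (y : EuclideanSpace ℝ (Fin 3)),
      ‖fderiv ℝ ((fun (_ : ℝ) (_ : EuclideanSpace ℝ (Fin 3)) => (1 : ℝ)) s) y‖ ≤
        0 * (1 / Real.sqrt (-s) + ‖y‖ / (-s)) *
          (fun (_ : ℝ) (_ : EuclideanSpace ℝ (Fin 3)) => (1 : ℝ)) s y := by
    intro s _ y
    simp
  have hc : ∀ s < (0 : ℝ), ∀ (y : EuclideanSpace ℝ (Fin 3)), curl (V s) y ≠ 0 →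
      ((-s) * (⟪fderiv ℝ (V s) y (vorticityDirection (curl (V s)) y),
          vorticityDirection (curl (V s)) y⟫
          - frobeniusNormSq (fderiv ℝ (vorticityDirection (curl (V s))) y)) - 1 + (1 - Λ)) *
          (fun (_ : ℝ) (_ : EuclideanSpace ℝ (Fin 3)) => (1 : ℝ)) s y ≤
        (-s) * (timeDeriv (fun (_ : ℝ) (_ : EuclideanSpace ℝ (Fin 3)) => (1 : ℝ)) s y +
          fderiv ℝ ((fun (_ : ℝ) (_ : EuclideanSpace ℝ (Fin 3)) => (1 : ℝ)) s) y (V s y) -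
          (Δ ((fun (_ : ℝ) (_ : EuclideanSpace ℝ (Fin 3)) => (1 : ℝ)) s)) y) := by
    intro s hs y hω
    have htd : timeDeriv (fun (_ : ℝ) (_ : EuclideanSpace ℝ (Fin 3)) => (1 : ℝ)) s y = 0 := by
      simp [timeDeriv]
    have hfd : fderiv ℝ ((fun (_ : ℝ) (_ : EuclideanSpace ℝ (Fin 3)) => (1 : ℝ)) s) y (V s y) = 0 := by
      simp
    have hΔ : (Δ ((fun (_ : ℝ) (_ : EuclideanSpace ℝ (Fin 3)) => (1 : ℝ)) s)) y = 0 :=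
      laplacian_const_eq_zero (1 : ℝ) y
    rw [htd, hfd, hΔ]
    have key := hcert s hs y hω
    nlinarith [key]
  have hω : ∀ s < 0, ∀ y, curl (V s) y = 0 := fun s hs y =>
    stretchCert_curl_eq_zero hV hh hh1 (by linarith : (0 : ℝ) < 1 - Λ) hgrad1 hc hs y
  have hub : ∀ s < 0, ∀ y, V s y = V s 0 := fun s hs y =>
    eq_of_curl_eq_zero_of_isDivFree_of_bounded ((hV.contDiff_slice hs).of_le (by norm_cast))
      (hω s hs) (hV.isDivFree hs) (fun z => hV.norm_le hs z) y 0
  exact hV.eq_zero_of_slice_const hub ht x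

/-- **T35 contains T32.** The sub-critical STRAIN hypothesis (`⟪∇V ξ, ξ⟫ ≤ (Λ/(−t))‖ξ‖²` for all
`ξ`, i.e. `(−t) λ_max(S) ≤ Λ`) implies the sub-critical CERTIFICATE hypothesis with the same `Λ`:
at a point with `ω ≠ 0` the direction `ξ` is a unit vector and `|∇ξ|²_F ≥ 0`. [folklore] -/
theorem subcriticalStrain_subcriticalCertificate {Λ : ℝ}
    {V : ℝ → EuclideanSpace ℝ (Fin 3) → EuclideanSpace ℝ (Fin 3)}
    (hstrain : ∀ t < 0, ∀ x ξ : EuclideanSpace ℝ (Fin 3),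
      ⟪fderiv ℝ (V t) x ξ, ξ⟫ ≤ Λ / (-t) * ‖ξ‖ ^ 2) :
    ∀ t < 0, ∀ x : EuclideanSpace ℝ (Fin 3), curl (V t) x ≠ 0 →
      (-t) * (⟪fderiv ℝ (V t) x (vorticityDirection (curl (V t)) x),
          vorticityDirection (curl (V t)) x⟫
        - frobeniusNormSq (fderiv ℝ (vorticityDirection (curl (V t))) x)) ≤ Λ := by
  intro t ht x hω
  have ht0 : 0 < -t := neg_pos.2 ht
  have hξ : ‖vorticityDirection (curl (V t)) x‖ = 1 := by
    rw [vorticityDirection_apply, norm_smul, norm_inv, norm_norm,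
      inv_mul_cancel₀ (norm_ne_zero_iff.2 hω)]
  have h1 : (-t) * ⟪fderiv ℝ (V t) x (vorticityDirection (curl (V t)) x),
      vorticityDirection (curl (V t)) x⟫ ≤ Λ := by
    have hL := hstrain t ht x (vorticityDirection (curl (V t)) x)
    rw [hξ, one_pow, mul_one] at hL
    have htne : (-t) ≠ 0 := ht0.ne'
    calc (-t) * ⟪fderiv ℝ (V t) x (vorticityDirection (curl (V t)) x),
          vorticityDirection (curl (V t)) x⟫ ≤ (-t) * (Λ / (-t)) :=
          mul_le_mul_of_nonneg_left hL ht0.le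
      _ = Λ := by rw [← mul_div_assoc, mul_div_cancel_left₀ Λ htne]
  have hF : 0 ≤ frobeniusNormSq (fderiv ℝ (vorticityDirection (curl (V t))) x) :=
    frobeniusNormSq_nonneg _
  nlinarith [mul_nonneg ht0.le hF]

/-- **E27 at CLASS level, UNCONDITIONAL: the sub-critical-certificate slice of the hypothesis class
of `RdssProfileTruncation` is EMPTY.** For every Type-I bound `M` and every `Λ < 1` there is no
member (any factor `c > 1`, any isometry `R`) all of whose smooth Type-I representatives `V`
(`IsTypeIAncientMild M V`, `V t =ᵐ u t` for `t < 0`) satisfy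
`(−t)(⟪∇V ξ, ξ⟫ − |∇ξ|²_F) ≤ Λ` wherever `curl V ≠ 0`. Representatives are quantified universally,
as in the E23/E24 wrappers, because the class speaks about an a.e. object; one representative
exists by `typeI_ancient_smoothRepresentative_ae`. [this file]
[cite: KochNadirashviliSereginSverak2009, Lemma 3.1 and Remark 6.1 (arXiv:0709.3599)] -/
theorem rdssClass_subcriticalCertificate_empty (M : ℝ) {Λ : ℝ} (hΛ : Λ < 1) :
    ¬ ∃ (c : ℝ) (R : (EuclideanSpace ℝ (Fin 3)) ≃ₗᵢ[ℝ] (EuclideanSpace ℝ (Fin 3)))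
        (u : ℝ → (EuclideanSpace ℝ (Fin 3)) → (EuclideanSpace ℝ (Fin 3))),
      1 < c ∧ IsAncientMildSolution 1 u ∧ (∀ t < 0, AEStronglyMeasurable (u t) volume) ∧
      IsRotatedDSS c R u ∧ HasTypeIDecay M u ∧
      (∀ V : ℝ → EuclideanSpace ℝ (Fin 3) → EuclideanSpace ℝ (Fin 3), IsTypeIAncientMild M V →
        (∀ t < 0, V t =ᵐ[volume] u t) →
        ∀ t < 0, ∀ x : EuclideanSpace ℝ (Fin 3), curl (V t) x ≠ 0 →
          (-t) * (⟪fderiv ℝ (V t) x (vorticityDirection (curl (V t)) x),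
              vorticityDirection (curl (V t)) x⟫
            - frobeniusNormSq (fderiv ℝ (vorticityDirection (curl (V t))) x)) ≤ Λ) ∧
      ¬ (∀ t < 0, u t =ᵐ[volume] 0) := by
  rintro ⟨c, R, u, -, hmild, hmeas, -, hdec, hcert, hne⟩
  obtain ⟨V, hT, -, hVu, -⟩ := typeI_ancient_smoothRepresentative_ae hmild hmeas hdec
  have hz : ∀ t < 0, ∀ x, V t x = 0 :=
    typeI_ancient_subcriticalCertificate_eq_zero hΛ hT (hcert V hT hVu)
  refine hne fun t ht => ?_
  have hVz : V t = 0 := funext fun x => by simpa using hz t ht x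
  exact (hVu t ht).symm.trans (Filter.EventuallyEq.of_eq hVz)

end Summit.NavierStokesRegularity.NavierStokesRegularity.Theorems.CertificateThreshold

end
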